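import Mathlib
import Summits.CriticalPhenomena.PercolationContinuityZ3.Theorems.PercNearOneGluingNoHeavyQuantTwoArcSunAffine
import HarnessLib

/-!
# QUANT lane R8, "FAR beyond trees", layer one on hairy cycles — the tied-random case: the SECOND least-likely tip may be assumed random (bridge, part 4)

builds on p205010 (kernel theorem, internal audit signed; external expert review pending)

Support file (`--supports stmt-CriticalPhenomena-4575`), seat `prim-quant-p1` (gen 17); memo `quant/prim-quant-p1-g17/FOR-LEAD-TWOCHAIN-B.md` §8.1 (i).
* `sunLaw_update_eq` (the law along `s ↦ h[a ↦ s]` is affine), `sunMarg_update_self` (`T_a(h[a ↦ s]) = s ρ_a`);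
* `sunMarg_le_sunLaw_two_le_of_interp` — if `s₀ ρ_a ≤ P_{h[a↦s₀]}(N ≥ 2)` for some `s₀ ≥ h a` then `T_a ≤ P_h(N ≥ 2)` (affinity; trivial at `0`);
* **`sunMarg_le_sunLaw_two_le_of_second_sure`** — `a` least likely (any hair weight), some other tip `b` with a SURE hair least likely among the tips `≠ a`,
  `Σ T > 2` ⟹ `T_a ≤ P(N ≥ 2)`: raise `h a` to `s₀ = min(1, ρ_b/ρ_a)`, where either `a` is a sure least-likely tip or `a`, `b` are tied with `b` sure
  least likely, apply `sunMarg_le_sunLaw_two_le_of_sure`, interpolate;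
* `SunTiedFAR₂ K` (the doubly-random tied case: additionally every least-likely tip among the others has `h < 1`), `sunTiedFAR_of_two : SunTiedFAR₂ K →
  SunTiedFAR K`, **`sunFAR_one_of_tied₂ : SunTiedFAR₂ K → SunFAR K 1`** (`K ≥ 2`).
No sorries; standard axioms. [this work]
-/

namespace Summit.CriticalPhenomena.PercolationContinuityZ3.Theorems

namespace Quant

namespace TwoArc

open Finset
open Summit.CriticalPhenomena.PercolationContinuityZ3.Theorems.HairyCycle

/-! ## A further reduction of the tied-random case: the SECOND least-likely tip may be assumed random -/

section second
variable {K : ℕ} (hK : 2 ≤ K) {g h : ℕ → ℝ} (hg : ∀ m, m ≤ K → 0 ≤ g m ∧ g m ≤ 1) (hh : ∀ k, k < K → 0 ≤ h k ∧ h k ≤ 1)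
include hK hg hh

omit hK hg hh in
/-- The law along the segment `s ↦ h[a ↦ s]` is affine. [this work] -/
theorem sunLaw_update_eq (g h : ℕ → ℝ) {a : ℕ} (ha : a < K) (Φ : Finset ℕ → Prop) (s : ℝ) :
    sunLaw K g (Function.update h a s) Φ
      = (1 - s) * sunLaw K g (Function.update h a 0) Φ + s * sunLaw K g (Function.update h a 1) Φ := by
  have := sunLaw_update_affine g (Function.update h a s) ha Φ
  simpa [Function.update_idem] using this

omit hK hg hh in
/-- The marginal of tip `a` along the segment: `T_a(h[a ↦ s]) = s · ρ_a`. [this work] -/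
theorem sunMarg_update_self (g h : ℕ → ℝ) (a : ℕ) (s : ℝ) :
    sunMarg K g (Function.update h a s) a = s * sunMarg K g (Function.update h a 1) a := by
  simp [sunMarg]

/-- **Interpolation**: if at some `s₀ ≥ h a` the world `h[a ↦ s₀]` satisfies `s₀ ρ_a ≤ P(N ≥ 2)`, then so does `h` itself
(`T_a ≤ P(N ≥ 2)`): the law is affine in `h a` and the inequality is trivial at `h a = 0`. [this work] -/
theorem sunMarg_le_sunLaw_two_le_of_interp {a : ℕ} (ha : a < K) {s₀ : ℝ} (hs₀ : h a ≤ s₀)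
    (H : s₀ * sunMarg K g (Function.update h a 1) a ≤ sunLaw K g (Function.update h a s₀) (fun R => 2 ≤ R.card)) :
    sunMarg K g h a ≤ sunLaw K g h (fun R => 2 ≤ R.card) := by
  have ha0 := (hh a ha).1
  have hb0 : ∀ k, k < K → 0 ≤ Function.update h a 0 k ∧ Function.update h a 0 k ≤ 1 := fun k hk => by
    by_cases hka : k = a
    · subst hka; simp
    · rw [Function.update_of_ne hka]; exact hh k hk
  have hb1 : ∀ k, k < K → 0 ≤ Function.update h a 1 k ∧ Function.update h a 1 k ≤ 1 := fun k hk => by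
    by_cases hka : k = a
    · subst hka; simp
    · rw [Function.update_of_ne hka]; exact hh k hk
  have L0 := sunLaw_nonneg hK hg hb0 (fun R => 2 ≤ R.card)
  have L1 := sunLaw_le_one hK hg hb1 (fun R => 2 ≤ R.card)
  have L1' := sunLaw_nonneg hK hg hb1 (fun R => 2 ≤ R.card)
  have hρ : 0 ≤ sunMarg K g (Function.update h a 1) a := by
    rw [← sunLaw_mem_eq_sunMarg hK hg hb1 ha]; exact sunLaw_nonneg hK hg hb1 _
  rw [sunLaw_update_eq g h ha _ s₀] at H
  have hself : sunLaw K g h (fun R => 2 ≤ R.card)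
      = (1 - h a) * sunLaw K g (Function.update h a 0) (fun R => 2 ≤ R.card)
        + h a * sunLaw K g (Function.update h a 1) (fun R => 2 ≤ R.card) := by
    have := sunLaw_update_eq g h ha (fun R => 2 ≤ R.card) (h a)
    rwa [Function.update_eq_self] at this
  rw [hself, sunMarg_eq_mul_update g h a]
  -- affine interpolation between s = 0 (value L₀ ≥ 0) and s = s₀ (H)
  by_cases hs : s₀ = 0
  · have : h a = 0 := le_antisymm (hs ▸ hs₀) ha0
    rw [this]; nlinarith
  have hs' : 0 < s₀ := lt_of_le_of_ne (ha0.trans hs₀) (Ne.symm hs)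
  -- h a = (h a / s₀) · s₀, convex combination of the two endpoint inequalities
  set t := h a / s₀ with ht
  have ht0 : 0 ≤ t := div_nonneg ha0 hs'.le
  have ht1 : t ≤ 1 := (div_le_one hs').2 hs₀
  have hts : h a = t * s₀ := by rw [ht, div_mul_cancel₀ _ hs]
  rw [hts]
  nlinarith [mul_le_mul_of_nonneg_left H ht0, mul_nonneg (sub_nonneg.2 ht1) L0]

/-- **THE SECOND LEAST-LIKELY TIP MAY BE ASSUMED RANDOM**: if `a` is least likely (any hair weight) and some OTHER tip `b` with a SURE hair is least likely
among the tips `≠ a`, then `T_a ≤ P(N ≥ 2)` (given `Σ T > 2`).  Proof: move `h a` up to `s₀ = min(1, ρ_b/ρ_a)`; there either `a` is a sure least-likely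
tip or `a` and `b` are tied with `b` sure least likely — the sure theorem applies — and interpolate. [this work] -/
theorem sunMarg_le_sunLaw_two_le_of_second_sure (hsum : (2 : ℝ) < ∑ k ∈ Finset.range K, sunMarg K g h k) {a : ℕ} (ha : a < K)
    (hmin : ∀ c, c < K → sunMarg K g h a ≤ sunMarg K g h c) {b : ℕ} (hb : b < K) (hba : b ≠ a) (hhb : h b = 1)
    (hbmin : ∀ c, c < K → c ≠ a → sunMarg K g h b ≤ sunMarg K g h c) :
    sunMarg K g h a ≤ sunLaw K g h (fun R => 2 ≤ R.card) := by
  set ρa := sunMarg K g (Function.update h a 1) a with hρa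
  set xb := sunMarg K g h b with hxb
  have ha01 := hh a ha
  have hb1 : ∀ k, k < K → 0 ≤ Function.update h a 1 k ∧ Function.update h a 1 k ≤ 1 := fun k hk => by
    by_cases hka : k = a
    · subst hka; simp
    · rw [Function.update_of_ne hka]; exact hh k hk
  have hρ0 : 0 ≤ ρa := by
    rw [hρa, ← sunLaw_mem_eq_sunMarg hK hg hb1 ha]; exact sunLaw_nonneg hK hg hb1 _
  have hxb0 : 0 ≤ xb := by
    rw [hxb, ← sunLaw_mem_eq_sunMarg hK hg hh hb]; exact sunLaw_nonneg hK hg hh _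
  have hTa : sunMarg K g h a = h a * ρa := sunMarg_eq_mul_update g h a
  have hTa_le : h a * ρa ≤ xb := hTa ▸ hmin b hb
  -- generic facts about the world h' = h[a ↦ s]
  have world : ∀ s : ℝ, h a ≤ s → s ≤ 1 →
      (∀ k, k < K → 0 ≤ Function.update h a s k ∧ Function.update h a s k ≤ 1) ∧
      (∀ c, c < K → c ≠ a → sunMarg K g (Function.update h a s) c = sunMarg K g h c) ∧
      sunMarg K g (Function.update h a s) a = s * ρa ∧
      (2 : ℝ) < ∑ k ∈ Finset.range K, sunMarg K g (Function.update h a s) k := fun s hs hs1 => by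
    have hbnd : ∀ k, k < K → 0 ≤ Function.update h a s k ∧ Function.update h a s k ≤ 1 := fun k hk => by
      by_cases hka : k = a
      · subst hka; simp; exact ⟨ha01.1.trans hs, hs1⟩
      · rw [Function.update_of_ne hka]; exact hh k hk
    have hoth : ∀ c, c < K → c ≠ a → sunMarg K g (Function.update h a s) c = sunMarg K g h c :=
      fun c _ hca => sunMarg_update_of_ne g h hca s
    have hself := sunMarg_update_self (K := K) g h a s
    refine ⟨hbnd, hoth, hself, ?_⟩
    have haK : a ∈ Finset.range K := Finset.mem_range.2 ha
    rw [← Finset.sum_erase_add _ _ haK] at hsum ⊢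
    rw [Finset.sum_congr rfl fun c hc => hoth c (Finset.mem_range.1 (Finset.mem_of_mem_erase hc)) (Finset.ne_of_mem_erase hc), hself]
    have : h a * ρa ≤ s * ρa := mul_le_mul_of_nonneg_right hs hρ0
    rw [hTa] at hsum
    linarith
  by_cases hcase : ρa ≤ xb
  · -- s₀ = 1: `a` becomes a sure least-likely tip
    obtain ⟨hbnd, hoth, hself, hsum'⟩ := world 1 ha01.2 le_rfl
    refine sunMarg_le_sunLaw_two_le_of_interp hK hg hh ha ha01.2 ?_
    have hmin' : ∀ c, c < K → sunMarg K g (Function.update h a 1) a ≤ sunMarg K g (Function.update h a 1) c := fun c hc => by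
      by_cases hca : c = a
      · rw [hca]
      · rw [hoth c hc hca, hself, one_mul]; exact hcase.trans (hbmin c hc hca)
    have hσ : 1 ≤ ∑ c ∈ (Finset.range K).erase a, sunMarg K g (Function.update h a 1) c := by
      have h1 : sunMarg K g (Function.update h a 1) a ≤ 1 := by
        rw [← sunLaw_mem_eq_sunMarg hK hg hbnd ha]; exact sunLaw_le_one hK hg hbnd _
      have := Finset.sum_erase_add (Finset.range K) (sunMarg K g (Function.update h a 1)) (Finset.mem_range.2 ha)
      linarith
    have := sunMarg_le_sunLaw_two_le_of_sure hK hg hbnd ha (by simp) hmin' hσ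
    rw [hself] at this
    exact this
  · -- s₀ = xb/ρa < 1: `a` and `b` tied, `b` sure least likely
    rw [not_le] at hcase
    have hρpos : 0 < ρa := lt_of_le_of_lt hxb0 hcase
    set s₀ := xb / ρa with hs₀
    have hs₀1 : s₀ ≤ 1 := (div_le_one hρpos).2 hcase.le
    have hs₀a : h a ≤ s₀ := by rw [hs₀, le_div_iff₀ hρpos]; exact hTa_le
    obtain ⟨hbnd, hoth, hself, hsum'⟩ := world s₀ hs₀a hs₀1
    refine sunMarg_le_sunLaw_two_le_of_interp hK hg hh ha hs₀a ?_
    have hs₀ρ : s₀ * ρa = xb := by rw [hs₀, div_mul_cancel₀ _ hρpos.ne']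
    -- apply the sure theorem to `b` in the world h[a ↦ s₀]
    have hhb' : Function.update h a s₀ b = 1 := by rw [Function.update_of_ne hba]; exact hhb
    have hminb : ∀ c, c < K → sunMarg K g (Function.update h a s₀) b ≤ sunMarg K g (Function.update h a s₀) c := fun c hc => by
      rw [hoth b hb hba]
      by_cases hca : c = a
      · rw [hca, hself, hs₀ρ]
      · rw [hoth c hc hca]; exact hbmin c hc hca
    have hσ : 1 ≤ ∑ c ∈ (Finset.range K).erase b, sunMarg K g (Function.update h a s₀) c := by
      have h1 : sunMarg K g (Function.update h a s₀) b ≤ 1 := by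
        rw [← sunLaw_mem_eq_sunMarg hK hg hbnd hb]; exact sunLaw_le_one hK hg hbnd _
      have := Finset.sum_erase_add (Finset.range K) (sunMarg K g (Function.update h a s₀)) (Finset.mem_range.2 hb)
      linarith
    have := sunMarg_le_sunLaw_two_le_of_sure hK hg hbnd hb hhb' hminb hσ
    rw [hoth b hb hba] at this
    rw [hs₀ρ]
    exact this

omit hK hg hh in
/-- **The doubly-random tied case** — `SunTiedFAR` with the extra normalisation that the least-likely tip among the OTHERS also has a random hair. [this work] -/
def SunTiedFAR₂ (K : ℕ) : Prop :=
  ∀ g h : ℕ → ℝ, (∀ m, m ≤ K → 0 ≤ g m ∧ g m ≤ 1) → (∀ k, k < K → 0 ≤ h k ∧ h k ≤ 1) →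
    (2 : ℝ) < ∑ k ∈ Finset.range K, sunMarg K g h k →
    ∀ a, a < K → (∀ b, b < K → sunMarg K g h a ≤ sunMarg K g h b) → h a < 1 →
      (∃ b, b < K ∧ b ≠ a ∧ sunMarg K g h b < sunMarg K g (Function.update h a 1) a) →
      (∀ b, b < K → b ≠ a → (∀ c, c < K → c ≠ a → sunMarg K g h b ≤ sunMarg K g h c) → h b < 1) →
      sunMarg K g h a ≤ sunLaw K g h (fun R => 2 ≤ R.card)

omit hg hh in
/-- `SunTiedFAR₂ K → SunTiedFAR K`: the second least-likely tip may be assumed random. [this work] -/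
theorem sunTiedFAR_of_two (H : SunTiedFAR₂ K) : SunTiedFAR K := by
  intro g h hg hh hsum a ha hmin hha hex
  by_cases hsec : ∀ b, b < K → b ≠ a → (∀ c, c < K → c ≠ a → sunMarg K g h b ≤ sunMarg K g h c) → h b < 1
  · exact H g h hg hh hsum a ha hmin hha hex hsec
  · simp only [not_forall, not_lt, exists_prop] at hsec
    obtain ⟨b, hb, hba, hbmin, hhb⟩ := hsec
    have hhb1 : h b = 1 := le_antisymm (hh b hb).2 hhb
    exact sunMarg_le_sunLaw_two_le_of_second_sure hK hg hh hsum ha hmin hb hba hhb1 hbmin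

omit hg hh in
/-- `SunFAR K 1` closed modulo the doubly-random tied case. [this work] -/
theorem sunFAR_one_of_tied₂ (H : SunTiedFAR₂ K) : SunFAR K 1 := sunFAR_one_of_tied hK (sunTiedFAR_of_two hK H)

end second

end TwoArc

end Quant

end Summit.CriticalPhenomena.PercolationContinuityZ3.Theorems
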